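import Summits.SmoothPoincare4.SmoothPoincare4.Theses.WeakReductionDescent
import Literature.Topology.FourManifolds.SphereTrisectionsSectors
import Literature.Topology.FourManifolds.TrisectionFunctorGKNaturality
import Literature.Topology.FourManifolds.WeaklyReducibleTrisections
import Literature.Topology.FourManifolds.CircleSurgery

/-!
# Disproof of `WeakReductionReduces` (K2, stmt-SmoothPoincare4-17908) — findings: NO KILL POSSIBLE SHORT
# OF `¬ SmoothPoincare4`; the hypotheses that carry truth value are `e : M ≃ₕ S⁴` and MINIMALITY, the
# hypotheses `4 ≤ g`, weak reducibility and the conclusion "reducible" carry METHOD only; the picked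
# line's three stubs are equally SPC4-implied (cdisprove seat, cycle 1, 2026-08-17; sorry-free)

K2 (`Theses.WeakReductionDescent.WeakReductionReduces`): for every smooth homotopy 4-sphere `M` (bare
binders + `e : M ≃ₕ S⁴`) and every WEAKLY REDUCIBLE Gay–Kirby trisection `T` of genus `g ≥ 4` that is
of MINIMAL genus for `M`, `T` is REDUCIBLE.

## What was attacked and what it gave (all kernel-checked statements are in this file unless cited)

* §0 SHIELD (re-derived from the birth attack `Cruxes/WeakReductionReduces/BirthAttack.lean`,
  `weakReductionReduces_of_spc4` / `not_spc4_of_not_weakReductionReduces`): `SmoothPoincare4 → K2`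
  by VACUITY — the round `S⁴` carries Gay–Kirby's genus-`0` trisection (PROVED tree theorem
  `sphere_genusZero_gkTrisection_holds`), transported along the diffeomorphism SPC4 provides
  (`IsGKTrisection.image_diffeomorph'`, PROVED), so no trisection of genus `≥ 1` of a homotopy
  sphere is minimal under SPC4.  Hence an unconditional `¬ K2` is an exotic `S⁴` (of trisection genus
  `≥ 4`): no finite / degenerate / junk-model kill exists.  LANDED as
  `Theorems/WeakReductionReduces/Negative/RefutationCost.lean` (this seat).
* ENCODING AUDIT (no junk, no vacuity of the wrong kind): `IsCurve`, `BoundsDisc`, `NonSep`,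
  `WeaklyReducible`, `Reducible` are the `let`-blocks of the decl; they agree by `Iff.rfl` with the
  tree's `Trisection.IsWeaklyReducible` / `Trisection.IsReducible` (`isWeaklyReducible_iff`,
  `isReducible_iff`), and transcribe AZ25 p. 6 / Remark 2.5 exactly (checked against the held text
  `paper-arxiv-2503.04607`, pp. 6–7).  The closed disc `𝔻²` carries the tree's genuine atlas
  (`ClosedBall.lean`: `instIsManifoldClosedBall`, `boundary_closedBall : ∂𝔻² = {‖x‖ = 1}` PROVED), so
  `d '' ∂𝔻² = c` is not junk; `Manifold.IsSmoothEmbedding (𝓡∂ 2) (𝓡 4)` = Mathlib immersion (charts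
  in maximal atlases, equation on the half-plane chart target) + topological embedding — satisfiable
  by genuine proper discs, so neither `WeaklyReducible` nor `Reducible` is vacuous by encoding.
  `IsGKTrisection` (corrected predicate with corner charts) is inhabited (genus `0` on `S⁴`, PROVED)
  and the genus parameter is pinned by `HasHandleDecomposition 2 H (handleCount 1 g)`; minimality
  quantifies over all `(g', k', T')`, so for every `M` DIFFEOMORPHIC to `S⁴` the hypothesis
  `4 ≤ g ∧ minimal` is FALSE (`not_minimal_of_diffeomorph`).  The only `M` on which the hypotheses
  could hold is an exotic sphere; none is constructible.
* §A LOAD-BEARING ANALYSIS (drop one hypothesis at a time):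
  - drop MINIMALITY → `WithoutMinimal` is UNSHIELDED: it specialises to the round sphere
    (`withoutMinimal_sphere`: every weakly reducible GK-trisection of `S⁴` of genus `≥ 4` is
    reducible), a statement in the territory of MSZ16 Conj. 3.11 / AZ25 §8: five-chain creation on a
    complicated tunnel-number-one knot generating `π₁(S¹ × S³)` gives weakly reducible
    `(3;1)`-trisections of `S⁴` that are "strong candidates for being non-standard" (AZ25 p. 27,
    Prop. 8.1, Q. 8.2), one genus up the same creation gives genus-`4` candidates.  EXPECTED FALSE,
    NOT CERTIFIED even in print ("current techniques for obstructing reducibility of non-minimal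
    trisections are limited", AZ25 p. 27).  Verdict: minimality is load-bearing (for truth value).
  - drop `e : M ≃ₕ S⁴` → `WithoutHomotopyEquiv` is UNSHIELDED (it speaks of every closed smooth
    4-manifold) and is FALSE IN PRINT ONE RUNG BELOW K2's range: the spun lens space `S₂` (spin of
    `ℝP³`) has a genus-`3` trisection (Meier; AZ25 Fig. 3, p. 6) which is weakly reducible (AZ25
    p. 6, caption of Fig. 3), of minimal genus and irreducible (AZ25 Lemma 2.7, p. 7: Chu–Tillmann
    `g ≥ χ − 2 + 3 rk π₁` and MSZ16 Thm 1.2).  At genus `4` (K2's first rung) the witness DESIGN is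
    `X = S¹ × L(p,q)`, `p ≥ 2`: EVERY genus-`4` GK-trisection of `X` is minimal and irreducible in
    print — `χ(X) = 0`, `π₁ = ℤ × ℤ/p` has rank `2`, so Chu–Tillmann gives `g(X) ≥ 4`; a reducing
    curve would split `X = X₁ # X₂` (separating) or split off `S¹ × S³` (non-separating), but `π₁(X)`
    is abelian, hence freely indecomposable, so one summand is simply connected of genus `≤ 3`, i.e.
    (MZ17 / MSZ16 / the other summand cannot have genus `1`) either an `S⁴`-stabilisation
    (contradicting `g(X) = 4`) or a standard piece with `b₂ ≥ 1` (contradicting `b₂(X) = 0`,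
    Künneth).  (Type bookkeeping adds `min kᵢ ≥ rk π₁ = 2`, so the type is `(4; 2, 2, 2)`; an earlier
    `(4; 2, 1, 0)` design on `S_p # ℂP²` is IMPOSSIBLE for the same reason: `k₃ = 0` forces `π₁ = 1`.)
    Hence `WithoutHomotopyEquiv` is false in print as soon as ONE weakly reducible genus-`4`
    trisection of `S¹ × L(p,q)` is exhibited, and Koenig (arXiv:1710.04345 = AGT 21 (2021), Thm 1 and
    §3 Case 1, read in the held text) supplies it: for `M = L(p,1)` the genus-1 splitting is FLIPPED
    by the swap `(z,w) ↦ (w,z)`, which lies in `U(2)` (connected, commuting with the `ℤ/p` action) and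
    is therefore isotopic to the identity, so its mapping torus is `S¹ × L(p,1)` and Case 1 gives a
    `(4; 2, 2, 2)`-trisection whose diagram has "a parallel red and blue curve as meridians of the
    tube connecting `Σ₁` and `Σ₃`" (a curve `c′` compressing in two handlebodies, non-separating since
    the three copies of `Σ` are tubed in a cycle) and the green Heegaard curve `c` of `M` on `Σ₂`
    (compressing in the third, non-separating, disjoint from `c′`) — a WEAK REDUCTION in AZ25's sense.
    So `WithoutHomotopyEquiv` is FALSE IN PRINT AT K2's OWN FIRST RUNG `g = 4` (witness
    `S¹ × L(p,1)`, `p ≥ 2`; ingredients Koenig Thm 1, Chu–Tillmann, MZ17, MSZ16 Thm 1.2, GK16,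
    Künneth; not formalisable here).  Verdict: `e` is load-bearing at every rung; any proof must use
    `π₁ = 1` (square-zero / Hantzsche / weight-one) at `g ≥ 4`, not only at rung 3.
  - drop `4 ≤ g` → NOT load-bearing: `fromOne_of` derives the `1 ≤ g` form from K2 + the route's own
    base supports `GenusThreeBase` (`g = 3`) and `LowGenusBase` (`g ≤ 2`) by the shield move (the
    tree's `Theorems/WeakReductionDescentGenusThreeBaseDichotomy.lean`,
    `isReducible_of_minimal_of_three_le`, already records the `3 ≤ g` form).  (`g = 0` is excluded only
    because "non-separating curve on a 2-sphere" needs Jordan on `F`; it is vacuous too.)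
  - drop WEAK REDUCIBILITY / strengthen the conclusion to `False` → still SPC4-implied: the single
    statement `NoMinimalFromFour` ("no smooth homotopy 4-sphere has a minimal GK-trisection of genus
    `≥ 4`") implies K2, the sibling `MinimalWeaklyReducibleFromFour` and EVERY mutation of K2 that
    keeps (`e`, `4 ≤ g`, minimal) (`anything_of_noMinimalFromFour`), and is itself implied by the
    summit (`noMinimalFromFour_of_spc4`); conversely `NoMinimalFromFour` + "genus ≤ 3 homotopy
    spheres are standard" (= `LowGenusBase` + the open `(3;1,1,1)` frontier, here the hypothesis
    `hThree`) + `TrisectionsExist` give the summit (`spc4_of_noMinimalFromFour`, `Nat.find` on the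
    genus).  So the weak-reduction language of K1/K2 at `g ≥ 4` carries the MECHANISM (Casson–Gordon
    one dimension up), not truth value: modulo the genus-≤-3 frontier, `K1∧K2` at `g ≥ 4` is worth
    exactly `NoMinimalFromFour`.  LANDED (inline form) in `Negative/RefutationCost.lean`.
* §C TARGETS = the picked line `loop_dichotomy` (PICKED.md; skeleton `Lines/loop_dichotomy.lean`,
  stubs D `stub_loopDichotomy`, L₃ `stub_loopFromGenusThree`, L₅ `stub_loopNoDescentFromFive`): all
  three are SPC4-implied (`stubD_of_spc4`: exit 2 via genus 0; `stubL3_of_spc4`: its conclusion IS the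
  summit's at `M`; `stubL5_of_spc4`: vacuity of `5 ≤ g ∧ minimal`), so NO stub is killable short of an
  exotic sphere either; joint sufficiency has no gap (the skeleton's `weakReductionReduces_of_pieces`
  is sorry-free).  Mis-statement audit of the stubs: `IsCircleSurgery (𝓡 4) (𝓡 4) X M ℓ` is oriented
  correctly ("`M` from `X` by surgery on `ℓ`", `CircleSurgery.lean`); L₃ needs no orientability
  hypothesis on `X` (a non-orientable `X` cannot yield an orientable `M` by surgery on a loop with
  trivial normal bundle, since `X = (X ∖ νℓ) ∪ S¹×D³` would be orientable); L₃ is a theorem in print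
  (χ(X) = 0 ⇒ Σk′ = g′+2 ⇒ MSZ16 range ⇒ X ≅ S¹×S³ ⇒ [ℓ] = ±1 ⇒ Pao / tree
  `isCircleSurgery_sphereOne_prod_sphereThree_sphereFour`).  No `stub-false` / `stub-misstated` note.
* §D NEGATIVE CONTROL for L₅'s mechanism (print, AZ25 Lemma 2.7): loop surgery RAISES trisection genus
  in the rational-homology setting (`g(S¹×S³) = 1 < 3 = g(S_p)`), so L₅ ("never LOWERS genus into a
  homotopy sphere") cannot follow from homology or from AZ25 Thm 5.1's inequality `g(X′_ℓ) ≤ g(X′)+2`;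
  it is `π₁`-sensitive.  (Consistent, no lever; recorded for the lead.)

WHY IT RESISTS: every statement in this crux's neighbourhood quantifies over MINIMAL trisections of
HOMOTOPY SPHERES (or concludes `M ≅ S⁴` for a homotopy sphere), and `S⁴`'s genus-`0` trisection makes
all of them consequences of `SmoothPoincare4`; the two unshielded shadows (`WithoutMinimal`,
`WithoutHomotopyEquiv`) are statements about `S⁴` resp. all 4-manifolds; for `S⁴` the expected
counterexamples (five-chain creations) cannot be certified irreducible by any known invariant (AZ25
p. 27), while for all 4-manifolds the `π₁`/`b₂` bookkeeping above certifies irreducibility and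
minimality of every genus-4 trisection of `S¹ × L(p,q)` and Koenig's flip-case trisection of
`S¹ × L(p,1)` is weakly reducible on its printed diagram: `e` is refuted-in-print as droppable.
-/

noncomputable section

-- the prescribed namespace repeats the component `SmoothPoincare4` (P = Sub)
set_option linter.dupNamespace false

open scoped Manifold ContDiff Topology ContinuousMap
open Set
open Literature.Topology.FourManifolds
open Summit.SmoothPoincare4.SmoothPoincare4.Theses.WeakReductionDescent

namespace Summit.SmoothPoincare4.SmoothPoincare4.Cruxes.WeakReductionReduces.Disproof

/-- Local notation: the round `4`-sphere. -/
local notation "𝕊⁴" => (Metric.sphere (0 : EuclideanSpace ℝ (Fin 5)) 1)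

/-! ## §0 Shield (re-derived; first proved in `BirthAttack.lean`) -/

/-- A diffeomorphism to the round sphere pulls Gay–Kirby's genus-`0` trisection of `S⁴` back, so no
GK-trisection of genus `≥ 1` of such an `M` is of minimal genus. [folklore] -/
theorem not_minimal_of_diffeomorph {M : Type} [TopologicalSpace M]
    [ChartedSpace (EuclideanSpace ℝ (Fin 4)) M] [IsManifold (𝓡 4) ∞ M]
    (Φ : M ≃ₘ⟮𝓡 4, 𝓡 4⟯ 𝕊⁴) {g : ℕ} (hg : 1 ≤ g)
    (hmin : ∀ (g' : ℕ) (k' : Fin 3 → ℕ) (T' : Fin 3 → Set M), IsGKTrisection M g' k' T' → g ≤ g') :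
    False := by
  obtain ⟨S₀, hS₀⟩ := sphere_genusZero_gkTrisection_holds
  have h0 := hmin 0 (fun _ => 0) (fun i => Φ.symm '' S₀ i)
    (hS₀.isGKTrisection.image_diffeomorph' Φ.symm)
  omega

/-- Under the summit no GK-trisection of genus `≥ 1` of a smooth homotopy 4-sphere is minimal.
[folklore] -/
theorem not_minimal_of_spc4 (h : _root_.SmoothPoincare4) {M : Type} [TopologicalSpace M] [T2Space M]
    [SecondCountableTopology M] [ChartedSpace (EuclideanSpace ℝ (Fin 4)) M] [IsManifold (𝓡 4) ∞ M]
    (e : M ≃ₕ 𝕊⁴) {g : ℕ} (hg : 1 ≤ g)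
    (hmin : ∀ (g' : ℕ) (k' : Fin 3 → ℕ) (T' : Fin 3 → Set M), IsGKTrisection M g' k' T' → g ≤ g') :
    False := by
  obtain ⟨Φ⟩ := h M ‹_› ‹_› e
  exact not_minimal_of_diffeomorph Φ hg hmin

/-- **Shield `S → C`.** `SmoothPoincare4 → WeakReductionReduces` (vacuity of `4 ≤ g ∧ minimal`).
[folklore] -/
theorem weakReductionReduces_of_spc4 (h : _root_.SmoothPoincare4) : WeakReductionReduces := by
  intro M _ _ _ _ _ e g k T _hT hg hmin _hwr
  exact (not_minimal_of_spc4 h e (by omega) hmin).elim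

/-- **Kill criterion.** A refutation of K2 refutes the summit. [folklore] -/
theorem not_spc4_of_not_weakReductionReduces (h : ¬ WeakReductionReduces) : ¬ _root_.SmoothPoincare4 :=
  fun hs => h (weakReductionReduces_of_spc4 hs)

/-! ## §A Load-bearing analysis -/

/-- K2 with the MINIMALITY hypothesis dropped (everything else verbatim; the `let`-blocks are the
tree's `Trisection.IsWeaklyReducible` / `Trisection.IsReducible`, definitionally). UNSHIELDED and
expected false (AZ25 §8), uncertified. -/
def WithoutMinimal : Prop :=
  ∀ (M : Type) [TopologicalSpace M] [T2Space M] [SecondCountableTopology M]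
    [ChartedSpace (EuclideanSpace ℝ (Fin 4)) M] [IsManifold (𝓡 4) ∞ M],
    (M ≃ₕ 𝕊⁴) → ∀ (g : ℕ) (k : Fin 3 → ℕ) (T : Fin 3 → Set M), IsGKTrisection M g k T → 4 ≤ g →
      Trisection.IsWeaklyReducible T → Trisection.IsReducible T

/-- **Why `WithoutMinimal` is unshielded**: it asserts of the ROUND sphere that every weakly reducible
GK-trisection of genus `≥ 4` is reducible — a statement `SmoothPoincare4` does not give (territory of
MSZ16 Conj. 3.11 / AZ25 Prop. 8.1, Q. 8.2). [folklore] -/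
theorem withoutMinimal_sphere (h : WithoutMinimal) (g : ℕ) (k : Fin 3 → ℕ) (T : Fin 3 → Set 𝕊⁴)
    (hT : IsGKTrisection 𝕊⁴ g k T) (hg : 4 ≤ g) (hwr : Trisection.IsWeaklyReducible T) :
    Trisection.IsReducible T :=
  h 𝕊⁴ (ContinuousMap.HomotopyEquiv.refl 𝕊⁴) g k T hT hg hwr

/-- K2 implies `WithoutMinimal` only together with `NoMinimalFromFour`-type information; conversely
`WithoutMinimal → K2` trivially (recorded as the contrapositive). [folklore] -/
theorem not_withoutMinimal_of_not_weakReductionReduces (h : ¬ WeakReductionReduces) :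
    ¬ WithoutMinimal := by
  intro hW
  refine h ?_
  intro M _ _ _ _ _ e g k T hT hg _hmin hwr
  exact (Trisection.isReducible_iff T).1
    (hW M e g k T hT hg ((Trisection.isWeaklyReducible_iff T).2 hwr))

/-- K2 with the HOMOTOPY-SPHERE hypothesis `e` dropped: every weakly reducible minimal GK-trisection of
genus `≥ 4` of ANY smooth 4-manifold (bare binders) is reducible. UNSHIELDED; false in print one rung
below (`S₂`, genus 3: AZ25 Fig. 3 + Lemma 2.7) and AT genus 4: every genus-4 trisection of
`S¹ × L(p,q)` (`p ≥ 2`) is minimal and irreducible in print, and Koenig's flip-case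
`(4; 2, 2, 2)`-trisection of `S¹ × L(p,1)` is weakly reducible on its printed diagram (module
docstring). Not formalisable here (no trisection diagrams in the tree). -/
def WithoutHomotopyEquiv : Prop :=
  ∀ (M : Type) [TopologicalSpace M] [T2Space M] [SecondCountableTopology M]
    [ChartedSpace (EuclideanSpace ℝ (Fin 4)) M] [IsManifold (𝓡 4) ∞ M],
    ∀ (g : ℕ) (k : Fin 3 → ℕ) (T : Fin 3 → Set M), IsGKTrisection M g k T → 4 ≤ g →
      (∀ (g' : ℕ) (k' : Fin 3 → ℕ) (T' : Fin 3 → Set M), IsGKTrisection M g' k' T' → g ≤ g') →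
      Trisection.IsWeaklyReducible T → Trisection.IsReducible T

/-- `WithoutHomotopyEquiv → K2` (recorded as the contrapositive): dropping `e` only strengthens.
[folklore] -/
theorem not_withoutHomotopyEquiv_of_not_weakReductionReduces (h : ¬ WeakReductionReduces) :
    ¬ WithoutHomotopyEquiv := by
  intro hW
  refine h ?_
  intro M _ _ _ _ _ _e g k T hT hg hmin hwr
  exact (Trisection.isReducible_iff T).1
    (hW M g k T hT hg hmin ((Trisection.isWeaklyReducible_iff T).2 hwr))

/-- K2 with `4 ≤ g` weakened to `1 ≤ g`. -/
def FromOne : Prop :=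
  ∀ (M : Type) [TopologicalSpace M] [T2Space M] [SecondCountableTopology M]
    [ChartedSpace (EuclideanSpace ℝ (Fin 4)) M] [IsManifold (𝓡 4) ∞ M],
    (M ≃ₕ 𝕊⁴) → ∀ (g : ℕ) (k : Fin 3 → ℕ) (T : Fin 3 → Set M), IsGKTrisection M g k T → 1 ≤ g →
      (∀ (g' : ℕ) (k' : Fin 3 → ℕ) (T' : Fin 3 → Set M), IsGKTrisection M g' k' T' → g ≤ g') →
      Trisection.IsWeaklyReducible T → Trisection.IsReducible T

/-- **`4 ≤ g` is not load-bearing**: the `1 ≤ g` form follows from K2 and the route's own base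
supports (`LowGenusBase`: genus `≤ 2` homotopy spheres are `S⁴`; `GenusThreeBase`: weakly reducible
genus-3 homotopy spheres are `S⁴`), because below genus 4 the supports make `M ≅ S⁴` and then
minimality fails (`not_minimal_of_diffeomorph`). [folklore] -/
theorem fromOne_of (h5 : LowGenusBase) (h4 : GenusThreeBase) (h2 : WeakReductionReduces) : FromOne := by
  intro M _ _ _ _ _ e g k T hT hg hmin hwr
  rcases Nat.lt_or_ge g 3 with hlt | hge
  · obtain ⟨Φ⟩ := h5 M e g k T hT (by omega)
    exact (not_minimal_of_diffeomorph Φ hg hmin).elim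
  rcases Nat.lt_or_ge g 4 with hlt4 | hge4
  · obtain rfl : g = 3 := by omega
    obtain ⟨Φ⟩ := h4 M e k T hT ((Trisection.isWeaklyReducible_iff T).1 hwr)
    exact (not_minimal_of_diffeomorph Φ (by omega) hmin).elim
  · exact (Trisection.isReducible_iff T).2
      (h2 M e g k T hT hge4 hmin ((Trisection.isWeaklyReducible_iff T).1 hwr))

/-- **The strongest variant**: no smooth homotopy 4-sphere has a GK-trisection of genus `≥ 4` that is
of minimal genus (K2 with weak reducibility deleted and the conclusion replaced by `False`). -/
def NoMinimalFromFour : Prop :=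
  ∀ (M : Type) [TopologicalSpace M] [T2Space M] [SecondCountableTopology M]
    [ChartedSpace (EuclideanSpace ℝ (Fin 4)) M] [IsManifold (𝓡 4) ∞ M],
    (M ≃ₕ 𝕊⁴) → ∀ (g : ℕ) (k : Fin 3 → ℕ) (T : Fin 3 → Set M), IsGKTrisection M g k T → 4 ≤ g →
      ¬ ∀ (g' : ℕ) (k' : Fin 3 → ℕ) (T' : Fin 3 → Set M), IsGKTrisection M g' k' T' → g ≤ g'

/-- The strongest variant is still SPC4-implied. [folklore] -/
theorem noMinimalFromFour_of_spc4 (h : _root_.SmoothPoincare4) : NoMinimalFromFour :=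
  fun M _ _ _ _ _ e _g _k _T _hT hg hmin => not_minimal_of_spc4 h e (by omega) hmin

/-- **Sandwich.** `NoMinimalFromFour` implies EVERY statement whose hypotheses contain
(`e`, a GK-trisection of genus `≥ 4`, minimality) — whatever the further hypotheses and whatever the
conclusion `C`. In particular it implies K2, `MinimalWeaklyReducibleFromFour`, and every mutation of
K2's weak-reducibility clause or of its conclusion. [folklore] -/
theorem anything_of_noMinimalFromFour (h : NoMinimalFromFour)
    (C : ∀ (M : Type) [TopologicalSpace M] [T2Space M] [SecondCountableTopology M]
      [ChartedSpace (EuclideanSpace ℝ (Fin 4)) M] [IsManifold (𝓡 4) ∞ M],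
      (M ≃ₕ 𝕊⁴) → ∀ (g : ℕ) (k : Fin 3 → ℕ) (T : Fin 3 → Set M), Prop)
    (M : Type) [TopologicalSpace M] [T2Space M] [SecondCountableTopology M]
    [ChartedSpace (EuclideanSpace ℝ (Fin 4)) M] [IsManifold (𝓡 4) ∞ M]
    (e : M ≃ₕ 𝕊⁴) (g : ℕ) (k : Fin 3 → ℕ) (T : Fin 3 → Set M) (hT : IsGKTrisection M g k T)
    (hg : 4 ≤ g)
    (hmin : ∀ (g' : ℕ) (k' : Fin 3 → ℕ) (T' : Fin 3 → Set M), IsGKTrisection M g' k' T' → g ≤ g') :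
    C M e g k T :=
  (h M e g k T hT hg hmin).elim

/-- `NoMinimalFromFour → K2`. [folklore] -/
theorem weakReductionReduces_of_noMinimalFromFour (h : NoMinimalFromFour) : WeakReductionReduces := by
  intro M _ _ _ _ _ e g k T hT hg hmin _hwr
  exact (h M e g k T hT hg hmin).elim

/-- `NoMinimalFromFour →` the sibling crux `MinimalWeaklyReducibleFromFour` (K1 for `g ≥ 4`).
[folklore] -/
theorem minimalWeaklyReducibleFromFour_of_noMinimalFromFour (h : NoMinimalFromFour) :
    MinimalWeaklyReducibleFromFour := by
  intro M _ _ _ _ _ e g k T hT hg hmin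
  exact (h M e g k T hT hg hmin).elim

/-- **Converse: the strongest variant plus the genus-≤-3 frontier IS the summit.** If genus `≤ 2`
homotopy spheres are standard (`LowGenusBase`, MSZ16/MZ17), genus-3 homotopy spheres are standard
(`hThree`: the open `(3;1,1,1)` frontier, in this route `DependentTripleAtThree` +
`DependentTripleGenusThreeStandard`), and trisections exist (`TrisectionsExist`, PROVED item), then
`NoMinimalFromFour → SmoothPoincare4`: take a trisection of least genus (`Nat.find`). [folklore] -/
theorem spc4_of_noMinimalFromFour (h5 : LowGenusBase)
    (hThree : ∀ (M : Type) [TopologicalSpace M] [T2Space M] [SecondCountableTopology M]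
      [ChartedSpace (EuclideanSpace ℝ (Fin 4)) M] [IsManifold (𝓡 4) ∞ M],
      (M ≃ₕ 𝕊⁴) → ∀ (k : Fin 3 → ℕ) (T : Fin 3 → Set M), IsGKTrisection M 3 k T →
        Nonempty (M ≃ₘ⟮𝓡 4, 𝓡 4⟯ 𝕊⁴))
    (h6 : TrisectionsExist) (h : NoMinimalFromFour) : _root_.SmoothPoincare4 := by
  unfold SmoothPoincare4 Literature.SPC4.SmoothPoincareConjectureFour
    ContinuousMap.HomotopyEquiv.NonemptyDiffeomorphSphere
  intro M _ _ _ _ _ e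
  classical
  have hex : ∃ g : ℕ, ∃ (k : Fin 3 → ℕ) (T : Fin 3 → Set M), IsGKTrisection M g k T := by
    obtain ⟨g, k, T, hT⟩ := h6 M e
    exact ⟨g, k, T, hT⟩
  obtain ⟨k₀, T₀, hT₀⟩ := Nat.find_spec hex
  have hmin : ∀ (g' : ℕ) (k' : Fin 3 → ℕ) (T' : Fin 3 → Set M), IsGKTrisection M g' k' T' →
      Nat.find hex ≤ g' :=
    fun g' k' T' hT' => Nat.find_min' hex ⟨k', T', hT'⟩
  rcases Nat.lt_or_ge (Nat.find hex) 3 with hlt | hge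
  · exact h5 M e _ k₀ T₀ hT₀ (by omega)
  rcases Nat.lt_or_ge (Nat.find hex) 4 with hlt4 | hge4
  · have h3 : Nat.find hex = 3 := by omega
    rw [h3] at hT₀
    exact hThree M e k₀ T₀ hT₀
  · exact (h M e _ k₀ T₀ hT₀ hge4 hmin).elim

/-- **`NoMinimalFromFour ↔ SmoothPoincare4`** modulo the genus-≤-3 frontier and existence of
trisections: the weak-reduction language of K1/K2 at `g ≥ 4` carries mechanism, not truth value.
[folklore] -/
theorem noMinimalFromFour_iff_spc4 (h5 : LowGenusBase)
    (hThree : ∀ (M : Type) [TopologicalSpace M] [T2Space M] [SecondCountableTopology M]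
      [ChartedSpace (EuclideanSpace ℝ (Fin 4)) M] [IsManifold (𝓡 4) ∞ M],
      (M ≃ₕ 𝕊⁴) → ∀ (k : Fin 3 → ℕ) (T : Fin 3 → Set M), IsGKTrisection M 3 k T →
        Nonempty (M ≃ₘ⟮𝓡 4, 𝓡 4⟯ 𝕊⁴))
    (h6 : TrisectionsExist) : NoMinimalFromFour ↔ _root_.SmoothPoincare4 :=
  ⟨spc4_of_noMinimalFromFour h5 hThree h6, noMinimalFromFour_of_spc4⟩

/-! ## §C Targets: the picked line `loop_dichotomy` — every stub is SPC4-implied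

The stub statements are copied VERBATIM from the registered skeleton `Lines/loop_dichotomy.lean`
(as `def`s, so that this file stays sorry-free and does not import the sorried skeleton). -/

/-- D = `stub_loopDichotomy`, verbatim. -/
def StubD : Prop :=
  ∀ (M : Type) [TopologicalSpace M] [T2Space M] [SecondCountableTopology M] [ChartedSpace (EuclideanSpace ℝ (Fin 4)) M] [IsManifold (𝓡 4) ((⊤ : ℕ∞) : WithTop ℕ∞) M], (M ≃ₕ (Metric.sphere (0 : EuclideanSpace ℝ (Fin 5)) 1)) → ∀ (g : ℕ) (k : Fin 3 → ℕ) (T : Fin 3 → Set M), Literature.Topology.FourManifolds.IsGKTrisection M g k T → 3 ≤ g → Literature.Topology.FourManifolds.Trisection.IsWeaklyReducible T → Literature.Topology.FourManifolds.Trisection.IsReducible T ∨ (∃ (g₁ : ℕ) (k₁ : Fin 3 → ℕ) (T₁ : Fin 3 → Set M), g₁ < g ∧ Literature.Topology.FourManifolds.IsGKTrisection M g₁ k₁ T₁) ∨ (∃ (X : Type) (_ : TopologicalSpace X) (_ : T2Space X) (_ : SecondCountableTopology X) (_ : ChartedSpace (EuclideanSpace ℝ (Fin 4)) X) (_ : IsManifold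 (𝓡 4) ((⊤ : ℕ∞) : WithTop ℕ∞) X) (g' : ℕ) (k' : Fin 3 → ℕ) (T' : Fin 3 → Set X) (ℓ : (Metric.sphere (0 : EuclideanSpace ℝ (Fin 2)) 1) → X), g' < g ∧ Literature.Topology.FourManifolds.IsGKTrisection X g' k' T' ∧ Manifold.IsSmoothEmbedding (𝓡 1) (𝓡 4) ((⊤ : ℕ∞) : WithTop ℕ∞) ℓ ∧ Literature.Topology.FourManifolds.IsCircleSurgery (𝓡 4) (𝓡 4) X M ℓ)

/-- L₃ = `stub_loopFromGenusThree`, verbatim. -/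
def StubL3 : Prop :=
  ∀ (X : Type) [TopologicalSpace X] [T2Space X] [SecondCountableTopology X] [ChartedSpace (EuclideanSpace ℝ (Fin 4)) X] [IsManifold (𝓡 4) ((⊤ : ℕ∞) : WithTop ℕ∞) X] (g' : ℕ) (k' : Fin 3 → ℕ) (T' : Fin 3 → Set X), Literature.Topology.FourManifolds.IsGKTrisection X g' k' T' → g' ≤ 3 → ∀ (ℓ : (Metric.sphere (0 : EuclideanSpace ℝ (Fin 2)) 1) → X), Manifold.IsSmoothEmbedding (𝓡 1) (𝓡 4) ((⊤ : ℕ∞) : WithTop ℕ∞) ℓ → ∀ (M : Type) [TopologicalSpace M] [T2Space M] [SecondCountableTopology M] [ChartedSpace (EuclideanSpace ℝ (Fin 4)) M] [IsManifold (𝓡 4) ((⊤ : ℕ∞) : WithTop ℕ∞) M], (M ≃ₕ (Metric.sphere (0 : EuclideanSpace ℝ (Fin 5)) 1)) → Literature.Topology.FourManifolds.IsCircleSurgery (𝓡 4) (𝓡 4) X M ℓ → Nonempty (Diffeomorph (𝓡 4) (𝓡 4) M (Metric.sphere (0 : EuclideanSpace ℝ (Fin 5)) 1) ((⊤ : ℕ∞)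 : WithTop ℕ∞))

/-- L₅ = `stub_loopNoDescentFromFive`, verbatim. -/
def StubL5 : Prop :=
  ∀ (M : Type) [TopologicalSpace M] [T2Space M] [SecondCountableTopology M] [ChartedSpace (EuclideanSpace ℝ (Fin 4)) M] [IsManifold (𝓡 4) ((⊤ : ℕ∞) : WithTop ℕ∞) M], (M ≃ₕ (Metric.sphere (0 : EuclideanSpace ℝ (Fin 5)) 1)) → ∀ (g : ℕ) (k : Fin 3 → ℕ) (T : Fin 3 → Set M), Literature.Topology.FourManifolds.IsGKTrisection M g k T → 5 ≤ g → (∀ (g'' : ℕ) (k'' : Fin 3 → ℕ) (T'' : Fin 3 → Set M), Literature.Topology.FourManifolds.IsGKTrisection M g'' k'' T'' → g ≤ g'') → ∀ (X : Type) [TopologicalSpace X] [T2Space X] [SecondCountableTopology X] [ChartedSpace (EuclideanSpace ℝ (Fin 4)) X] [IsManifold (𝓡 4) ((⊤ : ℕ∞) : WithTop ℕ∞) X] (g' : ℕ) (k' : Fin 3 → ℕ) (T' : Fin 3 → Set X), g' < g → Literature.Topology.FourManifolds.IsGKTrisection X g' k' T' → ∀ (ℓ : (Metric.sphere (0 : EuclideanSpace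 ℝ (Fin 2)) 1) → X), Manifold.IsSmoothEmbedding (𝓡 1) (𝓡 4) ((⊤ : ℕ∞) : WithTop ℕ∞) ℓ → ¬ Literature.Topology.FourManifolds.IsCircleSurgery (𝓡 4) (𝓡 4) X M ℓ

/-- **D is SPC4-implied** (through its middle exit: `M ≅ S⁴` has a genus-`0` trisection and
`0 < 3 ≤ g`). So D, though stated WITHOUT minimality, has no hypothesis-side falsifier either.
[folklore] -/
theorem stubD_of_spc4 (h : _root_.SmoothPoincare4) : StubD := by
  intro M _ _ _ _ _ e g _k _T _hT hg _hwr
  obtain ⟨Φ⟩ := h M ‹_› ‹_› e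
  obtain ⟨S₀, hS₀⟩ := sphere_genusZero_gkTrisection_holds
  exact Or.inr (Or.inl ⟨0, fun _ => 0, fun i => Φ.symm '' S₀ i, by omega,
    hS₀.isGKTrisection.image_diffeomorph' Φ.symm⟩)

/-- **L₃ is SPC4-implied** (its conclusion is the summit's conclusion at `M`). [folklore] -/
theorem stubL3_of_spc4 (h : _root_.SmoothPoincare4) : StubL3 := by
  intro X _ _ _ _ _ _g' _k' _T' _hT' _hg' _ℓ _hℓ M _ _ _ _ _ e _hsurg
  exact h M ‹_› ‹_› e

/-- **L₅ is SPC4-implied** (vacuity of `5 ≤ g ∧ minimal`). [folklore] -/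
theorem stubL5_of_spc4 (h : _root_.SmoothPoincare4) : StubL5 := by
  intro M _ _ _ _ _ e g _k _T _hT hg hmin X _ _ _ _ _ _g' _k' _T' _hlt _hT' _ℓ _hℓ _hsurg
  exact not_minimal_of_spc4 h e (by omega) hmin

/-- Hence a kill of ANY stub of the picked line is again an exotic 4-sphere. [folklore] -/
theorem not_spc4_of_not_stub (h : ¬ StubD ∨ ¬ StubL3 ∨ ¬ StubL5) : ¬ _root_.SmoothPoincare4 := by
  rintro hs
  rcases h with hD | hL3 | hL5
  · exact hD (stubD_of_spc4 hs)
  · exact hL3 (stubL3_of_spc4 hs)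
  · exact hL5 (stubL5_of_spc4 hs)

end Summit.SmoothPoincare4.SmoothPoincare4.Cruxes.WeakReductionReduces.Disproof

end
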